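/-
Copyright (c) 2026. All rights reserved.
Released under Apache 2.0 license as described in the file LICENSE.
Authors: abc-iut cell — seat abc-iut-L4-t8 (wave 2, L4 discharge; proof-only companion of
`HolomorphicCores.lean`, typed by abc-iut-L4-t2 / abc-iut-L4-t14; consumes abc-iut-L4-t14's
`HolomorphicCoresDeckProofs` and abc-iut-L4-t7's `UnitDiscAutomorphisms`).
-/
import Literature.AnabelianGeometry.AbsoluteAnabelian.HolomorphicCoresDeckProofs
import Literature.Analysis.Complex.UnitDiscAutomorphisms
import Mathlib.Geometry.Manifold.MFDeriv.FDeriv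
import Mathlib.Topology.CompactOpen
import Mathlib.Analysis.SpecialFunctions.Complex.Arg
import HarnessLib

/-!
# Proof-only companion of `HolomorphicCores`: the identity-component step of [AbsTopIII] Cor 2.4 (b)

S. Mochizuki, *Topics in absolute anabelian geometry III*, Cor 2.4 (b) (kurims p.54): for the
holomorphic universal covering `U → X` of a hyperbolic Riemann surface of finite type by an
Aut-holomorphic disc `𝕌`, "we obtain a natural injection
`π₁(X^top) = Aut(U^top/X^top) ↪ Aut⁰(𝕌) ⊆ Aut(𝕌)`", `Aut⁰(𝕌)` the connected component of the
identity of `Aut(𝕌)` for the compact-open topology (typed as `DeckGroupInAutIdComponent` in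
`HolomorphicCores.lean`, with `Aut(𝕌) = autSet`, `Aut⁰(𝕌) = autIdComponent`).

This file proves the IDENTITY-COMPONENT STEP and assembles the discharge
`DeckGroupInAutIdComponent_holds`; the holomorphy of deck transformations and the transport step
"biholomorphic self-homeomorphism ⇒ automorphism of the Aut-holomorphic space" are abc-iut-L4-t14's
PART 1 (`HolomorphicCoresDeckProofs`: `mdifferentiable_of_mem_deckGroup`,
`isMorphism_ofCharted_of_mdifferentiable`), the automorphisms of the disc are abc-iut-L4-t7's
`UnitDiscAutomorphisms` (`IsDiscAut.exists_eq_discRot`, Conway VI.2.5).  Route (no `PSL₂(ℝ)`): for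
an Aut-holomorphic disc `X` (`IsAutHolDisc X`, biholomorphism `d : X ≅ 𝔻`) and a biholomorphic
self-homeomorphism `γ`, `d γ d⁻¹` is a holomorphic automorphism of the disc, hence a Möbius map
`z ↦ c · φ_a(z)`; the Möbius family `(θ, a) ↦ d⁻¹ ∘ (e^{iθ} φ_a) ∘ d` is a continuous map from the
CONNECTED space `ℝ × 𝔻` into `Aut(𝕏)` with the compact-open topology (joint continuity of
`((c, a), z) ↦ c φ_a(z)` and currying), through the identity (`θ = 0`, `a = 0`) and through `γ`;
so `γ` lies in the connected component `Aut⁰(𝕏)` of the identity.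

* `continuousOn_discRot_uncurry` — joint continuity of the Möbius family on `{‖a‖ < 1, ‖z‖ < 1}`;
* `mem_autIdComponent_of_mdifferentiable` — every biholomorphic self-homeomorphism of an
  Aut-holomorphic disc lies in `Aut⁰`;
* `DeckGroupInAutIdComponent_holds` — the named fact of `HolomorphicCores.lean`, DISCHARGED
  (its hypotheses "of finite type" and "surjective" are idle and unused).

The disc-transport helpers (maps `unitDiscOpens → unitDiscOpens` versus holomorphic functions on
the ball) are private here; abc-iut-L4-t7's forthcoming `AutHolomorphicSpacesTransportProofs` has
public versions.  Refereed pre-IUT material; nothing here bears on the disputed [IUTchIII]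
Cor. 3.12; no side is taken.
-/

noncomputable section

namespace Literature.AnabelianGeometry.AbsoluteAnabelian

open _root_.TopologicalSpace _root_.Topology _root_.Set _root_.Metric _root_.Function
open scoped _root_.Manifold _root_.ContDiff ComplexConjugate
open Literature.Analysis.Complex

universe u

/-! ### The Möbius family is jointly continuous -/

/-- **Joint continuity of the Möbius family** `((c, a), z) ↦ c · φ_a(z) = c (z - a)/(1 - ā z)` on
`{‖a‖ < 1, ‖z‖ < 1}` (the denominator does not vanish there). [cite: Conway1978, Ch. VI Thm. 2.5] -/
theorem continuousOn_discRot_uncurry :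
    ContinuousOn (fun q : (ℂ × ℂ) × ℂ => discRot q.1.1 q.1.2 q.2)
      {q : (ℂ × ℂ) × ℂ | ‖q.1.2‖ < 1 ∧ ‖q.2‖ < 1} := by
  have hc : Continuous fun q : (ℂ × ℂ) × ℂ => q.1.1 := continuous_fst.comp continuous_fst
  have ha : Continuous fun q : (ℂ × ℂ) × ℂ => q.1.2 := continuous_snd.comp continuous_fst
  have hz : Continuous fun q : (ℂ × ℂ) × ℂ => q.2 := continuous_snd
  have hnum : Continuous fun q : (ℂ × ℂ) × ℂ => q.2 - q.1.2 := hz.sub ha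
  have hden : Continuous fun q : (ℂ × ℂ) × ℂ => 1 - conj q.1.2 * q.2 :=
    continuous_const.sub ((Complex.continuous_conj.comp ha).mul hz)
  have hne : ∀ q ∈ {q : (ℂ × ℂ) × ℂ | ‖q.1.2‖ < 1 ∧ ‖q.2‖ < 1}, 1 - conj q.1.2 * q.2 ≠ 0 := by
    rintro q ⟨h1, h2⟩ h
    have hlt : ‖conj q.1.2 * q.2‖ < 1 := by
      rw [norm_mul, Complex.norm_conj]
      calc ‖q.1.2‖ * ‖q.2‖ ≤ 1 * ‖q.2‖ := by gcongr
        _ = ‖q.2‖ := one_mul _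
        _ < 1 := h2
    have : conj q.1.2 * q.2 = 1 := (sub_eq_zero.1 h).symm
    rw [this, norm_one] at hlt
    exact lt_irrefl _ hlt
  have : (fun q : (ℂ × ℂ) × ℂ => discRot q.1.1 q.1.2 q.2) =
      fun q => q.1.1 * ((q.2 - q.1.2) / (1 - conj q.1.2 * q.2)) := by
    funext q; rw [discRot_apply, _root_.Complex.discMobius_apply]
  rw [this]
  exact hc.continuousOn.mul (hnum.continuousOn.div hden.continuousOn hne)

/-! ### The open unit disc: subtype versus total functions (private transport helpers) -/

section DiscTransport

-- adapted from abc-iut-L4-t7's staged `AutHolomorphicSpacesTransportProofs` (re-proved over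
-- abc-iut-L4-t14's `mdifferentiableAt_subtype_iff` / `mdifferentiableAt_subtypeVal_comp_iff`)

/-- Membership in `unitDiscOpens`. [cite: MochizukiAbsTopIII2015, Definition 2.1 (i) p.50] -/
private theorem mem_unitDiscOpens {z : ℂ} : z ∈ unitDiscOpens ↔ ‖z‖ < 1 := by
  show z ∈ ball (0 : ℂ) 1 ↔ _
  exact mem_ball_zero_iff

/-- Points of `unitDiscOpens` lie in the ball.
[cite: MochizukiAbsTopIII2015, Definition 2.1 (i) p.50] -/
private theorem coe_mem_ball (x : unitDiscOpens) : (x : ℂ) ∈ ball (0 : ℂ) 1 := x.2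

/-- Points of `unitDiscOpens` have norm `< 1`.
[cite: MochizukiAbsTopIII2015, Definition 2.1 (i) p.50] -/
private theorem norm_coe_lt_one (x : unitDiscOpens) : ‖(x : ℂ)‖ < 1 := mem_unitDiscOpens.1 x.2

/-- The total extension (by `b`) of a map `S` out of `unitDiscOpens` agrees with `S` on the disc.
[cite: MochizukiAbsTopIII2015, Definition 2.1 (i) p.50] -/
private theorem extend_apply_coe {β : Type*} (S : unitDiscOpens → β) (b : β) (x : unitDiscOpens) :
    Function.extend Subtype.val S (fun _ => b) x = S x :=
  Subtype.val_injective.extend_apply _ _ x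

/-- The total extension of `S` at a point of the ball.
[cite: MochizukiAbsTopIII2015, Definition 2.1 (i) p.50] -/
private theorem extend_apply_of_mem {β : Type*} (S : unitDiscOpens → β) (b : β) {z : ℂ}
    (hz : z ∈ ball (0 : ℂ) 1) : Function.extend Subtype.val S (fun _ => b) z = S ⟨z, hz⟩ :=
  extend_apply_coe S b ⟨z, hz⟩

/-- A `ℂ`-differentiable self-map of `unitDiscOpens` has holomorphic total extension on the ball.
[cite: MochizukiAbsTopIII2015, Definition 2.1 (i) p.50] -/
private theorem differentiableOn_extend_of_mdifferentiable {S : unitDiscOpens → unitDiscOpens}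
    (hS : MDifferentiable 𝓘(ℂ, ℂ) 𝓘(ℂ, ℂ) S) :
    DifferentiableOn ℂ (Function.extend Subtype.val (Subtype.val ∘ S) (fun _ => 0)) (ball 0 1) := by
  intro z hz
  have hx := hS ⟨z, hz⟩
  rw [← mdifferentiableAt_subtypeVal_comp_iff] at hx
  have heq : (Subtype.val ∘ S) = fun x : unitDiscOpens =>
      Function.extend Subtype.val (Subtype.val ∘ S) (fun _ => (0 : ℂ)) x :=
    funext fun x => (extend_apply_coe _ _ x).symm
  rw [heq, mdifferentiableAt_subtype_iff] at hx
  exact (mdifferentiableAt_iff_differentiableAt.1 hx).differentiableWithinAt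

/-- A self-map of `unitDiscOpens` restricting a holomorphic function is `ℂ`-differentiable.
[cite: MochizukiAbsTopIII2015, Definition 2.1 (i) p.50] -/
private theorem mdifferentiable_of_differentiableOn {f : ℂ → ℂ}
    (hf : DifferentiableOn ℂ f (ball 0 1)) {S : unitDiscOpens → unitDiscOpens}
    (hS : ∀ x, (S x : ℂ) = f x) : MDifferentiable 𝓘(ℂ, ℂ) 𝓘(ℂ, ℂ) S := by
  intro x
  rw [← mdifferentiableAt_subtypeVal_comp_iff]
  have heq : (Subtype.val ∘ S) = fun x : unitDiscOpens => f x := funext hS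
  rw [heq, mdifferentiableAt_subtype_iff]
  exact mdifferentiableAt_iff_differentiableAt.2 (hf.differentiableAt (isOpen_ball.mem_nhds x.2))

/-- The total extension of a self-map of `unitDiscOpens` maps the ball into the ball.
[cite: MochizukiAbsTopIII2015, Definition 2.1 (i) p.50] -/
private theorem mapsTo_extend (S : unitDiscOpens → unitDiscOpens) :
    MapsTo (Function.extend Subtype.val (Subtype.val ∘ S) (fun _ => (0 : ℂ))) (ball 0 1)
      (ball 0 1) := by
  intro z hz
  rw [extend_apply_of_mem _ _ hz]
  exact (S ⟨z, hz⟩).2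

/-- A holomorphic automorphism of the disc (`IsDiscAut`) induces a biholomorphic
self-homeomorphism of `unitDiscOpens`. [cite: Conway1978, Ch. VI Thm. 2.5] -/
private theorem exists_homeomorph_unitDiscOpens_of_isDiscAut {f : ℂ → ℂ} (hf : IsDiscAut f) :
    ∃ T : unitDiscOpens ≃ₜ unitDiscOpens, (∀ x, (T x : ℂ) = f x) ∧
      MDifferentiable 𝓘(ℂ, ℂ) 𝓘(ℂ, ℂ) T ∧ MDifferentiable 𝓘(ℂ, ℂ) 𝓘(ℂ, ℂ) T.symm := by
  obtain ⟨g, hgd, hgm, hgf, hfg⟩ := hf.exists_inverse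
  let toF : unitDiscOpens → unitDiscOpens := fun x => ⟨f x, hf.mapsTo x.2⟩
  let invF : unitDiscOpens → unitDiscOpens := fun x => ⟨g x, hgm x.2⟩
  have hc1 : Continuous toF :=
    (hf.continuousOn.comp_continuous continuous_subtype_val fun x => x.2).subtype_mk _
  have hc2 : Continuous invF :=
    (hgd.continuousOn.comp_continuous continuous_subtype_val fun x => x.2).subtype_mk _
  let T : unitDiscOpens ≃ₜ unitDiscOpens :=
    { toFun := toF
      invFun := invF
      left_inv := fun x => Subtype.ext (hgf x x.2)
      right_inv := fun x => Subtype.ext (hfg x x.2)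
      continuous_toFun := hc1
      continuous_invFun := hc2 }
  exact ⟨T, fun x => rfl,
    mdifferentiable_of_differentiableOn hf.differentiableOn (S := T) fun x => rfl,
    mdifferentiable_of_differentiableOn hgd (S := T.symm) fun x => rfl⟩

/-- `unitDiscOpens` is connected (a convex set).
[cite: MochizukiAbsTopIII2015, Definition 2.1 (i) p.50] -/
private theorem connectedSpace_unitDiscOpens : ConnectedSpace unitDiscOpens :=
  isConnected_iff_connectedSpace.1 ((convex_ball (0 : ℂ) 1).isConnected ⟨0, mem_ball_self one_pos⟩)

end DiscTransport

/-! ### The identity-component step -/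

section IdComponent

attribute [local instance] homeoCompactOpen

variable {X : Type u} [TopologicalSpace X] [ChartedSpace ℂ X]

/-- **[AbsTopIII] Cor 2.4 (b), identity-component step.**  Let `X` be an Aut-holomorphic disc
(`IsAutHolDisc X`: biholomorphic to the open unit disc).  Then every biholomorphic
self-homeomorphism `γ` of `X` lies in the identity component `Aut⁰(𝕏)` of `Aut(𝕏)` for the
compact-open topology: conjugated to the disc, `γ` is a Möbius map `c · φ_a` (Conway VI.2.5), and
the Möbius family `(θ, a) ↦ d⁻¹ (e^{iθ} φ_a) d` is a continuous map of the connected space `ℝ × 𝔻`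
into `Aut(𝕏)` (biholomorphic maps are automorphisms of `𝕏`, abc-iut-L4-t14's
`isMorphism_ofCharted_of_mdifferentiable`) through `id` and `γ`.
[cite: MochizukiAbsTopIII2015, Corollary 2.4 (b) p.54] -/
theorem mem_autIdComponent_of_mdifferentiable (hX : IsAutHolDisc X)
    (γ : X ≃ₜ X) (hγ : MDifferentiable 𝓘(ℂ, ℂ) 𝓘(ℂ, ℂ) γ)
    (hγ' : MDifferentiable 𝓘(ℂ, ℂ) 𝓘(ℂ, ℂ) γ.symm) :
    γ ∈ autIdComponent (AutHolStructure.ofCharted X) := by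
  obtain ⟨d, hd, hd'⟩ := hX.exists_biholomorphic
  -- conjugate to the disc: `g = d ∘ γ ∘ d⁻¹`
  set g : unitDiscOpens ≃ₜ unitDiscOpens := d.symm.trans (γ.trans d) with hg_def
  have hg : MDifferentiable 𝓘(ℂ, ℂ) 𝓘(ℂ, ℂ) g := hd.comp (hγ.comp hd')
  have hg' : MDifferentiable 𝓘(ℂ, ℂ) 𝓘(ℂ, ℂ) g.symm := hd.comp (hγ'.comp hd')
  -- its total extension is a holomorphic automorphism of the disc, hence a Möbius map
  set f : ℂ → ℂ := Function.extend Subtype.val (Subtype.val ∘ g) (fun _ => 0) with hf_def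
  set f' : ℂ → ℂ := Function.extend Subtype.val (Subtype.val ∘ g.symm) (fun _ => 0) with hf'_def
  have hf : IsDiscAut f := by
    refine IsDiscAut.mk' (differentiableOn_extend_of_mdifferentiable hg) (mapsTo_extend g)
      (differentiableOn_extend_of_mdifferentiable hg') (mapsTo_extend g.symm) ?_ ?_
    · intro z hz
      have e1 : f z = (g ⟨z, hz⟩ : ℂ) := extend_apply_of_mem (Subtype.val ∘ g) 0 hz
      have e2 : f' (g ⟨z, hz⟩ : ℂ) = (g.symm (g ⟨z, hz⟩) : ℂ) :=
        extend_apply_coe (Subtype.val ∘ g.symm) 0 _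
      show f' (f z) = z
      rw [e1, e2, g.symm_apply_apply]
    · intro z hz
      have e1 : f' z = (g.symm ⟨z, hz⟩ : ℂ) := extend_apply_of_mem (Subtype.val ∘ g.symm) 0 hz
      have e2 : f (g.symm ⟨z, hz⟩ : ℂ) = (g (g.symm ⟨z, hz⟩) : ℂ) :=
        extend_apply_coe (Subtype.val ∘ g) 0 _
      show f (f' z) = z
      rw [e1, e2, g.apply_symm_apply]
  obtain ⟨c₀, a₀, hc₀, ha₀, -, hfeq⟩ := hf.exists_eq_discRot
  -- the Möbius homeomorphisms of the disc, parametrised by `ℝ × 𝔻`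
  have key : ∀ q : ℝ × unitDiscOpens, ∃ T : unitDiscOpens ≃ₜ unitDiscOpens,
      (∀ x, (T x : ℂ) = discRot (Complex.exp (q.1 * Complex.I)) q.2 x) ∧
      MDifferentiable 𝓘(ℂ, ℂ) 𝓘(ℂ, ℂ) T ∧ MDifferentiable 𝓘(ℂ, ℂ) 𝓘(ℂ, ℂ) T.symm := by
    intro q
    have hc : ‖Complex.exp (q.1 * Complex.I)‖ = 1 := by
      rw [Complex.norm_exp_ofReal_mul_I]
    exact exists_homeomorph_unitDiscOpens_of_isDiscAut
      (isDiscAut_discRot hc (norm_coe_lt_one q.2))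
  choose T hT hTd hTd' using key
  -- the family `F q = d⁻¹ ∘ T q ∘ d` of biholomorphic self-homeomorphisms of `X`
  let F : ℝ × unitDiscOpens → (X ≃ₜ X) := fun q => d.trans ((T q).trans d.symm)
  have hFapply : ∀ q x, F q x = d.symm (T q (d x)) := fun q x => rfl
  have hF_mem : ∀ q, F q ∈ autSet (AutHolStructure.ofCharted X) := by
    intro q
    have h1 : MDifferentiable 𝓘(ℂ, ℂ) 𝓘(ℂ, ℂ) (F q) := hd'.comp ((hTd q).comp hd)
    have h2 : MDifferentiable 𝓘(ℂ, ℂ) 𝓘(ℂ, ℂ) (F q).symm := hd'.comp ((hTd' q).comp hd)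
    exact ⟨isMorphism_ofCharted_of_mdifferentiable (F q) h1 h2,
      isMorphism_ofCharted_of_mdifferentiable (F q).symm h2 (by simpa using h1)⟩
  -- continuity of the family for the compact-open topology
  have hF_cont : Continuous F := by
    rw [continuous_induced_rng]
    apply ContinuousMap.continuous_of_continuous_uncurry
    show Continuous fun qx : (ℝ × unitDiscOpens) × X => d.symm (T qx.1 (d qx.2))
    refine d.symm.continuous.comp ?_
    rw [Topology.IsInducing.subtypeVal.continuous_iff]
    refine (continuousOn_discRot_uncurry.comp_continuous
      (f := fun qx : (ℝ × unitDiscOpens) × X =>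
        ((Complex.exp (qx.1.1 * Complex.I), (qx.1.2 : ℂ)), (d qx.2 : ℂ))) ?_ ?_).congr ?_
    · refine ((Continuous.prodMk ?_ ?_).prodMk ?_)
      · exact Complex.continuous_exp.comp
          ((Complex.continuous_ofReal.comp (continuous_fst.comp continuous_fst)).mul
            continuous_const)
      · exact continuous_subtype_val.comp (continuous_snd.comp continuous_fst)
      · exact continuous_subtype_val.comp (d.continuous.comp continuous_snd)
    · intro qx
      exact ⟨norm_coe_lt_one qx.1.2, norm_coe_lt_one (d qx.2)⟩
    · intro qx
      simp only [Function.comp_apply, hT]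
  -- the family as a continuous map of the connected space `ℝ × 𝔻` into the subspace `Aut(𝕏)`
  haveI : ConnectedSpace unitDiscOpens := connectedSpace_unitDiscOpens
  let Φ : ℝ × unitDiscOpens → autSet (AutHolStructure.ofCharted X) := fun q => ⟨F q, hF_mem q⟩
  have hΦ : Continuous Φ := hF_cont.subtype_mk _
  have hrange : IsPreconnected (range Φ) := isPreconnected_range hΦ
  -- base point: `θ = 0`, `a = 0` gives the identity
  have h0mem : (0 : ℂ) ∈ unitDiscOpens := mem_unitDiscOpens.2 (by simp)
  have hF0 : F (0, ⟨0, h0mem⟩) = Homeomorph.refl X := by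
    ext x
    rw [hFapply]
    have h1 : (T (0, ⟨0, h0mem⟩) (d x) : ℂ) = (d x : ℂ) := by
      rw [hT]
      simp
    rw [Subtype.ext h1, Homeomorph.symm_apply_apply]
    rfl
  -- the point `(arg c₀, a₀)` gives `γ`
  have ha₀mem : a₀ ∈ unitDiscOpens := mem_unitDiscOpens.2 ha₀
  have hFγ : F (Complex.arg c₀, ⟨a₀, ha₀mem⟩) = γ := by
    ext x
    rw [hFapply]
    have hexp : Complex.exp ((Complex.arg c₀ : ℝ) * Complex.I) = c₀ := by
      have := Complex.norm_mul_exp_arg_mul_I c₀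
      rwa [hc₀, Complex.ofReal_one, one_mul] at this
    have h1 : (T (Complex.arg c₀, ⟨a₀, ha₀mem⟩) (d x) : ℂ) = (d (γ x) : ℂ) := by
      rw [hT]
      change discRot (Complex.exp ((Complex.arg c₀ : ℝ) * Complex.I)) a₀ (d x) = _
      rw [hexp, ← hfeq (coe_mem_ball (d x)), hf_def, extend_apply_coe, Function.comp_apply,
        hg_def]
      simp
    rw [Subtype.ext h1, Homeomorph.symm_apply_apply]
  -- conclude: `γ` lies in the connected component of the identity
  have hsub := hrange.subset_connectedComponent (mem_range_self (0, ⟨0, h0mem⟩))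
  refine ⟨Φ (Complex.arg c₀, ⟨a₀, ha₀mem⟩), ?_, ?_⟩
  · have hbase : Φ (0, ⟨0, h0mem⟩) =
        ⟨Homeomorph.refl X, (AutHolStructure.ofCharted X).isMorphism_id,
          (AutHolStructure.ofCharted X).isMorphism_id⟩ := Subtype.ext hF0
    rw [← hbase]
    exact hsub (mem_range_self _)
  · exact hFγ

end IdComponent

/-! ### The discharge -/

/-- **[AbsTopIII] Cor 2.4 (b) — DISCHARGED.**  The named fact `DeckGroupInAutIdComponent` of
`HolomorphicCores.lean` HOLDS: for a Riemann surface `X` and a holomorphic covering `p : U → X` by a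
simply connected Riemann surface `U` that is an Aut-holomorphic disc, every deck transformation of
`p` lies in the identity component `Aut⁰(𝕌)` of `Aut(𝕌)` (compact-open topology) — "we obtain a
natural injection `π₁(X^top) = Aut(U^top/X^top) ↪ Aut⁰(𝕌) ⊆ Aut(𝕌)`".  Proof: deck transformations
are biholomorphic (abc-iut-L4-t14, `mdifferentiable_of_mem_deckGroup`), and biholomorphic
self-homeomorphisms of an Aut-holomorphic disc lie in `Aut⁰`
(`mem_autIdComponent_of_mdifferentiable`).  The hypotheses "of finite type" and "surjective" of
the typed fact are not used.
[cite: MochizukiAbsTopIII2015, Corollary 2.4 (b) p.54] -/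
theorem DeckGroupInAutIdComponent_holds : DeckGroupInAutIdComponent := by
  intro X _ _ _ _ Ucov _ _ _ _ p _ hp _ hpd hdisc γ hγ
  exact mem_autIdComponent_of_mdifferentiable hdisc γ (mdifferentiable_of_mem_deckGroup hp hpd hγ)
    (mdifferentiable_symm_of_mem_deckGroup hp hpd hγ)

end Literature.AnabelianGeometry.AbsoluteAnabelian
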